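import Summits.BirchSwinnertonDyer.Rank1Residual.Supersingular.KobayashiSqueezeReal
import HarnessLib

/-!
# Kobayashi's signed main conjecture AT A RANK-ZERO PAIR WHERE `BSD(E,p)` IS SETTLED, on the REAL
# objects — the rank-zero converse for classes X6 / X7 (`a_p = 0`)
# (cell `b2b-bsdres`, supersingular family, prover B = unit `b2b-bsdres-additive-p3`, gen 3; X7 joint)

HONEST FRAMING (run/shared/lean/b2b/bsd-rank1-residual/, verbatim in every file): the goal of the
cell is to DELETE the COMBINATION-SHAPED residual classes of the Birch–Swinnerton-Dyer formula for
ALL analytic-rank `≤ 1` elliptic curves over `ℚ` — "full BSD formula for every rank `≤ 1` curve in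
class `C`" assembled STRICTLY from published theorems — so that the rank-`≤ 1` remainder becomes
exactly the CONSTRUCTION-SHAPED classes, which are TYPED (missing-input `Prop`s), NOT attempted.
This is not "finishing BSD". THEOREMS ONLY (no definition, no named fact, nothing about any curve is
asserted); X6 / X7 stay CONSTRUCTION-SHAPED; nothing booked. PER PAIR; NOT a class theorem.

## What this file does

Gen 2 proved the rank-zero CONVERSE on an abstract datum (`SignedDatum.charIdealEq_of_bsdp_of_analyticRank_eq_zero`,
`Supersingular/SignedSqueeze.lean`, p208039): (K) + (P) + `p ∤ c` + (MC↑) + `BSD(E,p)` ⇒ `(ξ) = (L)`.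
With every `±` input now a tree object or a named published fact (see `KobayashiSqueezeReal.lean`,
this gen, for the list), this file states it for the REAL objects and in the cell's own currency:

* `kobayashiMainConjecture_of_bsdp_of_analyticRank_eq_zero` — `p` odd good, `a_p = 0`, `ρ̄_{E,p}`
  onto, `r_an = 0`, and **`BSD(E,p)` SETTLED** (`hB : BSDp W p` — at such a pair the cell settles it
  from published inputs by Wuthrich 2014 Prop. 21 + `p ∤ #Ш_an` (lever L1) or + a descent bit) ⇒
  **the cell's typed input `KobayashiMainConjecture W p ε` HOLDS at the pair, for EITHER sign `ε`**,
  granted BY NAME Kobayashi 2003 Thm. 1.2 (A94), Thm. 4.1 (A98, integral under `p`-adic surjectivity ⇐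
  mod-`p` surjectivity at a good odd `p`), B. D. Kim 2013 Cor. 3.15 = (K) (A95), the period-unit facts
  (`h5`, `h3`), GZK, modularity; (P) is PROVED (x10b `IsPollackPair.constantCoeff_kobayashiL`).
  Chain: `ξ ∣ L^ε`; `ord_p ξ(0) = ord_p(∏c_ℓ·#Ш)` (K + GZK); `ord_p L^ε(0) = ord_p [0]⁺_f =
  ord_p(L(E,1)/Ω_E)` (`p ∤ c_ε`, `ϖ ∈ ℤ_p^×`) `= ord_p(#Ш_an·∏c_ℓ)` (`p ∤ #tors`) `= ord_p(#Ш·∏c_ℓ)`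
  (BSD) — equal valuations turn the divisibility into `(ξ) = (L^ε)`; `g := ϖ L^ε`.
* `X6.kobayashiMainConjecture_of_bsdp_of_analyticRank_eq_zero`,
  `X7.kobayashiMainConjecture_of_bsdp_of_analyticRank_eq_zero` — class readings.

So at every rank-`0` X6 / X7 (`a_p = 0`, surj) pair the cell has CLOSED from published inputs — e.g.
the Wuthrich-L1 pairs (`p ∤ #Ш_an`), the bulk of the supersingular rows of the census — Kobayashi's
`±` main conjecture for `(E, p, ε)`, the statement ANNOUNCED class-wide for semistable `E` by
Burungale–Skinner–Tian–Wan (arXiv:2409.01350 Thm. 1.3, PRE), is a consequence IN THE KERNEL of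
refereed inputs named above, for both signs. This is bookkeeping of what the cell's closures imply
(writer's "consequences" paragraph); it books nothing and moves no label.

References: [Kobayashi2003] Thm. 1.2, Thm. 4.1, (3.6), Conjecture (p. 2); [BDKim2013] Cor. 3.15;
[Pollack2003] Prop. 6.18; [GreenbergVatsal2000] §3 Remark 3.4; [Wuthrich2014] Lemma 20, Prop. 21;
[Miller2011LMS] Def. 1.1; [BurungaleSkinnerTianWan2024] Thm. 1.3 (PRE, for comparison only).
-/

set_option autoImplicit false

noncomputable section

open scoped Classical MatrixGroups ModularForm

open CongruenceSubgroup WeierstrassCurve Literature.NumberTheory.EllipticCurves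
  Literature.NumberTheory.EllipticCurves.ModularForms
  Literature.NumberTheory.EllipticCurves.Rank1Residual
  Literature.NumberTheory.EllipticCurves.Rank1Residual.Typed
  Literature.NumberTheory.EllipticCurves.Kobayashi2003 ZpExtension
  Summit.BirchSwinnertonDyer.Rank1Residual.X1.MuLambda

namespace Summit.BirchSwinnertonDyer.Rank1Residual.Supersingular

section Converse

variable (W : WeierstrassCurve ℚ) [W.IsElliptic] [W.IsGloballyMinimal] (p : ℕ) [Fact p.Prime]

/-- **`BSD(E,p)` settled in rank `0` ⇒ Kobayashi's main conjecture for `(E, p, ε)` at the pair, on the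
real objects.** Let `p` be an odd prime of good reduction of `E = W` with `a_p = 0`, `ρ̄_{E,p}`
surjective, `ord_{s=1}L(E,s) = 0`, and suppose `BSDp W p` holds. Granted BY NAME Kobayashi 2003
Thm. 1.2 (`h12`), Thm. 4.1 (`h41`; `p`-adic surjectivity from `hs` via Serre / Wuthrich Lemma 20
`hL20`), B. D. Kim 2013 Cor. 3.15 (`hKim`, (K)), the period-unit facts (`h5`, `h3`), GZK (`hGZK`)
and modularity (`hmod'`): `KobayashiMainConjecture W p ε` — for every admissible
`(κ, γ, f, ϖ, (L⁺,L⁻), D)`, `X^ε` is torsion and `Char(X^ε) = (ϖ·L^ε)`. Proof: `Char(X^ε) = (ξ)`,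
`ξ ∣ L^ε` (A98), `ord_p ξ(0) = ord_p ∏c_ℓ + ord_p #Ш` ((K) + GZK), `ord_p L^ε(0) = ord_p(c_ε·[0]⁺_f) =
ord_p(L(E,1)/Ω_E)` ((P) proved, `p ∤ c_ε`, `ord_p ϖ = 0`) `= ord_p #Ш_an + ord_p ∏c_ℓ` (`p ∤ #tors`)
`= ord_p #Ш + ord_p ∏c_ℓ` (BSD), so the cofactor is a unit. PER PAIR; nothing asserted beyond the binders.
[cite: Kobayashi2003, Thm. 1.2 (p. 2), Thm. 4.1 (p. 8), (3.6) (p. 7) and Conjecture (p. 2)]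
[cite: BDKim2013, Cor. 3.15 (p. 199)] [cite: GreenbergVatsal2000, §3 Remark 3.4] [cite: Miller2011LMS, Def. 1.1] -/
theorem kobayashiMainConjecture_of_bsdp_of_analyticRank_eq_zero
    (h12 : Kobayashi2003.thm12_signedSelmerDual_finite_torsion)
    (h41 : Kobayashi2003.thm41_signedCharIdeal_divisibility)
    (hKim : BDKim2013.cor315_signedCharValue_rankZero)
    (h5 : realPeriodRat_eq_unit_mul_plusPeriod) (h3 : realPeriodRat_eq_unit_mul_plusPeriod_three)
    (hL20 : Wuthrich2014.lemma20_surjective_threeAdic_of_semistable)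
    (hGZK : rank_eq_analyticRank_of_analyticRank_le_one) (hmod' : hasEntireLFunction_rat)
    (hp : p ≠ 2) (hgood : W.HasGoodReductionAtPrime p) (hap : W.frobeniusTrace p = 0)
    (hs : Surj W p) (h0 : W.analyticRank = 0) (hB : BSDp W p) (ε : ℤˣ) :
    KobayashiMainConjecture W p ε := by
  intro κ γ hκ hγ hγ' _ f hf ϖ hϖ Lplus Lminus hPP D
  have hpP : p.Prime := Fact.out
  -- Thm. 1.2: `X^ε` finitely generated and torsion
  haveI hfin : Module.Finite (IwasawaAlgebra p) D.X := h12.moduleFinite hp hgood hap hκ hγ D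
  have hX : Module.IsTorsion (IwasawaAlgebra p) D.X := h12.isTorsion hp hgood hap hκ hγ D
  refine ⟨hX, ?_⟩
  -- a generator `ξ` of `Char(X^ε)`, Kobayashi's `L^ε`, and (MC↑): `ξ ∣ L^ε`
  obtain ⟨ξ, hξ⟩ := (charIdeal_isPrincipal_holds p D.X).principal
  have hξ' : D.charIdeal = Ideal.span {ξ} := hξ
  set L := kobayashiL ε Lplus Lminus with hL_def
  have hL : IsSignedPAdicLFunction f p ε L := hPP.isSignedPAdicLFunction_kobayashiL ε
  have hsurj : ∀ m : ℕ, W.HasSurjectiveModNGaloisRep (p ^ m : ℕ) :=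
    surjective_pow_of_surj_of_good W p hL20 hp hgood hs
  have hU : ξ ∣ L := h41.dvd_of_charIdeal_eq_span hp hgood hap hf hκ hγ hγ' hL D hX hsurj hξ'
  -- `L(E,1) ≠ 0`, irreducibility, the period ratio is a unit
  have hL1 : W.entireLFunction 1 ≠ 0 := (W.analyticRank_eq_zero_iff_holds (hmod' W)).1 h0
  have hirr : W.HasIrreducibleModPGaloisRep p :=
    hasIrreducibleModPGaloisRep_of_dvd_frobeniusTrace W p hp
      (W.not_dvd_minimalDiscriminantInt_of_hasGoodReductionAtPrime' p hgood) (by rw [hap]; exact dvd_zero _)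
  have hvϖ : padicValRat p ϖ = 0 := padicValRat_periodRatio_eq_zero h5 h3 W p hp hgood hirr f hf ϖ hϖ
  have hϖ0 : ϖ ≠ 0 := by
    intro hz
    rw [hz, Rat.cast_zero, zero_mul] at hϖ
    exact (IsNewform0.plusPeriod_pos_holds hf.1 hf.coeffField_eq_bot).ne' hϖ.symm
  -- (K): `ξ(0) ≠ 0`, `ord_p ξ(0) = ord_p ∏c + ord_p #Ш`
  have hK : (⟨ξ, 0, 0⟩ : SignedDatum W p).EulerCharacteristic :=
    BDKim2013.cor315_signedCharValue_rankZero.eulerCharacteristic hKim hp hgood hap hκ hγ D ⟨hfin, hX⟩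
      hξ'
  obtain ⟨hξ0ne, hvξ⟩ := valuation_constantCoeff_xi W p hGZK hL1 ⟨ξ, 0, 0⟩ hK
  -- (P), proved: `L(0) = c_ε · [0]⁺_f`; `t := ϖ·[0]⁺_f = L(E,1)/Ω_E`
  have hLε := hPP.constantCoeff_kobayashiL hp hf hgood hap ε
  set s : ℚ := ratPlusSymbol f 0 with hs_def
  set t : ℚ := ϖ * s with ht_def
  have hLval : W.entireLFunction 1 = (((s : ℝ) * plusPeriod f : ℝ) : ℂ) := hf.entireLFunction_one_eq
  have ht : W.entireLFunction 1 / (W.realPeriodRat : ℂ) = ((t : ℚ) : ℂ) := by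
    rw [hLval, ← hϖ, div_eq_iff (Complex.ofReal_ne_zero.mpr W.realPeriodRat_pos_holds.ne'), ht_def]
    push_cast
    ring
  have hs0 : s ≠ 0 := by
    intro hz
    apply hL1
    rw [hLval, hz]
    simp
  have ht0 : t ≠ 0 := mul_ne_zero hϖ0 hs0
  -- `ord_p L(0) = ord_p s = ord_p t`
  have hcne : kobayashiConst p ε ≠ 0 := fun hz ↦
    not_dvd_kobayashiConst hp ε (by rw [hz]; exact dvd_zero p)
  have hc0 : (kobayashiConst p ε : ℚ_[p]) ≠ 0 := by exact_mod_cast hcne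
  have hsQ0 : ((s : ℚ) : ℚ_[p]) ≠ 0 := by exact_mod_cast hs0
  have hL0ne : ((PowerSeries.constantCoeff L : ℤ_[p]) : ℚ_[p]) ≠ 0 := by
    rw [hLε]; exact mul_ne_zero hc0 hsQ0
  have hvL : (((PowerSeries.constantCoeff L : ℤ_[p]) : ℚ_[p])).valuation = padicValRat p t := by
    rw [hLε, Padic.valuation_mul hc0 hsQ0, Padic.valuation_natCast,
      padicValNat.eq_zero_of_not_dvd (not_dvd_kobayashiConst hp ε), Padic.valuation_ratCast, ht_def,
      padicValRat.mul hϖ0 hs0, hvϖ]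
    simp
  -- `BSD(E,p)`: `ord_p #Ш_an = ord_p #Ш` with `#Ш_an = t·#tors²/∏c`, `p ∤ #tors`
  haveI : Finite W.sha := (hGZK W (by omega)).2
  obtain ⟨q, hq, hvq⟩ := missingPPartAt_of_bsdp W p hB
  have hq' : q = t * (W.torsionOrder : ℚ) ^ 2 / (W.tamagawaProduct : ℚ) := by
    have hqq := hq.symm.trans (shaAn_eq_of_analyticRank_eq_zero W hGZK h0 ht)
    exact_mod_cast hqq
  rw [hq', padicValRat_shaAn_witness W p hirr ht0] at hvq
  -- equal valuations ⇒ `(ξ) = (L)`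
  have hv : (((PowerSeries.constantCoeff ξ : ℤ_[p]) : ℚ_[p])).valuation =
      (((PowerSeries.constantCoeff L : ℤ_[p]) : ℚ_[p])).valuation := by
    have hvξ' : (((PowerSeries.constantCoeff ξ : ℤ_[p]) : ℚ_[p])).valuation =
        (padicValNat p W.tamagawaProduct : ℤ) + padicValNat p W.shaOrder := hvξ
    rw [hvξ', hvL]
    linarith
  have hspan : Ideal.span ({ξ} : Set (IwasawaAlgebra p)) = Ideal.span {L} :=
    span_eq_span_of_dvd_of_valuation_constantCoeff_eq hU hL0ne hv
  -- `g := ϖ·L`, `ϖ ∈ ℤ_p^×`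
  obtain ⟨u, hu⟩ := exists_units_coe_eq_ratCast hϖ0 hvϖ
  obtain ⟨hspan', hι⟩ := span_C_units_mul_eq u L
  refine ⟨PowerSeries.C (u : ℤ_[p]) * L, ?_, ?_⟩
  · rw [hξ', hspan, hspan']
  · rw [hι, hu]

/-- **X6 ∧ `r_an = 0` ∧ `BSD(E,p)` settled ⇒ Kobayashi's main conjecture for `(E, p, ε)` at the pair,
BOTH signs** (odd `p`; `a_p = 0` and surj automatic on X6: `ClassX6.frobeniusTrace_eq_zero`,
`ClassX6.surj`). E.g. every X6 rank-`0` census pair closed by Wuthrich-L1 (`p ∤ #Ш_an`). PER PAIR.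
[cite: Kobayashi2003, Thm. 1.2, Thm. 4.1 and Conjecture (p. 2)] [cite: BDKim2013, Cor. 3.15 (p. 199)]
[cite: Serre1972, §5.4 Prop. 21 i)] -/
theorem X6.kobayashiMainConjecture_of_bsdp_of_analyticRank_eq_zero
    (h12 : Kobayashi2003.thm12_signedSelmerDual_finite_torsion)
    (h41 : Kobayashi2003.thm41_signedCharIdeal_divisibility)
    (hKim : BDKim2013.cor315_signedCharValue_rankZero)
    (h5 : realPeriodRat_eq_unit_mul_plusPeriod) (h3 : realPeriodRat_eq_unit_mul_plusPeriod_three)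
    (hL20 : Wuthrich2014.lemma20_surjective_threeAdic_of_semistable)
    (hGZK : rank_eq_analyticRank_of_analyticRank_le_one) (hmod' : hasEntireLFunction_rat)
    (hp : p ≠ 2) (hX : ClassX6 W p) (h0 : W.analyticRank = 0) (hB : BSDp W p) (ε : ℤˣ) :
    KobayashiMainConjecture W p ε :=
  _root_.Summit.BirchSwinnertonDyer.Rank1Residual.Supersingular.kobayashiMainConjecture_of_bsdp_of_analyticRank_eq_zero
    W p h12 h41 hKim h5 h3 hL20 hGZK hmod' hp hX.1.1 (ClassX6.frobeniusTrace_eq_zero W p hp hX)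
    (ClassX6.surj W p hp hX) h0 hB ε

/-- **X7 ∧ `r_an = 0` ∧ surj(p) ∧ `a_p = 0` ∧ `BSD(E,p)` settled ⇒ Kobayashi's main conjecture for
`(E, p, ε)` at the pair, BOTH signs** (odd `p`; `a_p = 0` automatic for `p ≥ 5`, a hypothesis at
`p = 3`; surj displayed). PER PAIR. [cite: Kobayashi2003, Thm. 1.2, Thm. 4.1 and Conjecture (p. 2)]
[cite: BDKim2013, Cor. 3.15 (p. 199)] [cite: Wuthrich2014, Lemma 20 (p. 399)] -/
theorem X7.kobayashiMainConjecture_of_bsdp_of_analyticRank_eq_zero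
    (h12 : Kobayashi2003.thm12_signedSelmerDual_finite_torsion)
    (h41 : Kobayashi2003.thm41_signedCharIdeal_divisibility)
    (hKim : BDKim2013.cor315_signedCharValue_rankZero)
    (h5 : realPeriodRat_eq_unit_mul_plusPeriod) (h3 : realPeriodRat_eq_unit_mul_plusPeriod_three)
    (hL20 : Wuthrich2014.lemma20_surjective_threeAdic_of_semistable)
    (hGZK : rank_eq_analyticRank_of_analyticRank_le_one) (hmod' : hasEntireLFunction_rat)
    (hp : p ≠ 2) (hX : ClassX7 W p) (hap : W.frobeniusTrace p = 0) (hs : Surj W p)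
    (h0 : W.analyticRank = 0) (hB : BSDp W p) (ε : ℤˣ) :
    KobayashiMainConjecture W p ε :=
  _root_.Summit.BirchSwinnertonDyer.Rank1Residual.Supersingular.kobayashiMainConjecture_of_bsdp_of_analyticRank_eq_zero
    W p h12 h41 hKim h5 h3 hL20 hGZK hmod' hp hX.1.1 hap hs h0 hB ε

end Converse

end Summit.BirchSwinnertonDyer.Rank1Residual.Supersingular

end
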